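import Summits.AtomisticToContinuum.FouriersLaw.Theorems.PhononMeanFreePathIncoherentChannelCommonPastBound
import Summits.AtomisticToContinuum.FouriersLaw.Theorems.PhononMeanFreePathIncoherentChannelTwoHorizonsMean
import Summits.AtomisticToContinuum.FouriersLaw.Theorems.PhononMeanFreePathCoherentDephasingTimeWeighted

/-!
# Engine ⇒ (T1): the forecast-loss envelope gives an `N`-uniform time-moment of order `> 1` of `r_N²`

Support file (`--supports stmt-AtomisticToContinuum-11811`, registered helper stub
`timeWeightedResponse_of_forecastLoss`, line `two-horizons-forecast-loss` of crux
`PhononMeanFreePath.IncoherentChannel`, lead c7 wave 1), over the route vocabulary of `PhononMeanFreePathDefs`: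
the `(N+1)`-site pinned anharmonic chain `pinnedChain ω₂ lam β γ` with both Langevin baths at `T > 0`,
forecast norm `S_N(t) = fnorm … N t = ‖K_t p_N‖²_{L²(μ_T)}` and end-to-end pair correlation
`r_N(t) = pairCorr … N t = ⟨p_0, K_t p_N⟩_{μ_T}`.

* `timeWeightedResponse_of_forecastLoss` — the line's registered ENGINE (an `N`-uniform envelope
  `S_N(t) ≤ C (1+t)^{-α}`, `α > 2`) implies VERBATIM the hypothesis (T1) of the sibling crux's theorem
  `CoherentDephasing.TimeWeighted.coherentDephasing_of_timeWeightedResponse`: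
  `∃ a > 1, C', ∀ N R, 0 < R → ∫_{(0,R]} (1+t)^a r_N(t)² dt ≤ C'`.
  Proof: `a = α/2`; Cauchy–Schwarz `r_N² ≤ T·S_N` (`stub_commonPastBound`), so on `t > 0`
  `(1+t)^{α/2} r_N(t)² ≤ T|C| (1+t)^{-α/2}`, which is integrable on `(0,∞)` (`α/2 > 1`); take
  `C' = ∫_{(0,∞)} T|C| (1+t)^{-α/2} dt`, independent of `N` and `R`.

Composed with that theorem it gives a second, independent route engine ⇒ `CoherentDephasing`; the
composition is not restated here because its statement coincides with the landed
`coherentDephasing_of_forecastLoss` (`PhononMeanFreePathIncoherentChannelTwoHorizonsMean`).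

Pure real analysis on top of landed theorems; no definition, no `sorry`, standard axioms.
-/

noncomputable section

namespace Summit.AtomisticToContinuum.FouriersLaw.Theorems.PhononMeanFreePath

open MeasureTheory Set Filter Topology
open scoped NNReal
open Literature.MathematicalPhysics.KineticTheory.HeatConduction

/-- **Registered helper stub `timeWeightedResponse_of_forecastLoss` (engine ⇒ T1).** If for every admissible
parameter point the forecast norm has an `N`-uniform envelope `S_N(t) ≤ C (1+t)^{-α}` (`α > 2`, all `N`, `t ≥ 0`),
then for every admissible parameter point there are `a > 1` and `C'` with
`∫_{(0,R]} (1+t)^a r_N(t)² dt ≤ C'` for every `N` and every `R > 0`: take `a = α/2` and use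
`r_N(t)² ≤ T·S_N(t)` (Cauchy–Schwarz), so the weighted square is dominated by the `N`-independent integrable
majorant `T|C|(1+t)^{-α/2}` on `(0,∞)`. [folklore] -/
theorem timeWeightedResponse_of_forecastLoss : (∀ ω₂ lam β γ : ℝ, 0 < ω₂ → 0 < lam → 0 < β → 0 < γ → ∀ T : ℝ, 0 < T → ∃ C α : ℝ, 2 < α ∧ ∀ (N : ℕ) (t : ℝ), 0 ≤ t → fnorm ω₂ lam β γ T N t ≤ C * (1 + t) ^ (-α)) → ∀ ω₂ lam β γ : ℝ, 0 < ω₂ → 0 < lam → 0 < β → 0 < γ → ∀ T : ℝ, 0 < T → ∃ a C : ℝ, 1 < a ∧ ∀ (N : ℕ) (R : ℝ), 0 < R → ∫ t in Ioc 0 R, (1 + t) ^ a * (pairCorr ω₂ lam β γ T N t) ^ 2 ≤ C := by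
  intro h ω₂ lam β γ hω hl hβ hγ T hT
  obtain ⟨C, α, hα2, hS⟩ := h ω₂ lam β γ hω hl hβ hγ T hT
  have hs1 : 1 < α / 2 := by linarith
  have ha0 : 0 ≤ α / 2 := by linarith
  -- the fixed-`N` dictionary: measurability of `r_N`, Cauchy–Schwarz `r_N² ≤ T·S_N`, and `S_N ≤ T`
  obtain ⟨hmeasAll, hCS, -⟩ := stub_commonPastBound ω₂ lam β γ hω hl hβ hγ T hT
  have hdict := commonPastBound_forecastDictionary ω₂ lam β γ hω hl.le hβ.le hγ.le T hT
  -- the `N`-independent dominating function and the constant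
  have hK0 : 0 ≤ T * |C| := mul_nonneg hT.le (abs_nonneg C)
  have hdomI : IntegrableOn (fun t : ℝ => T * |C| * (1 + t) ^ (-(α / 2))) (Ioi 0) :=
    (twoHorizons_integrableOn_one_add_rpow_neg hs1).const_mul (T * |C|)
  refine ⟨α / 2, ∫ t in Ioi (0 : ℝ), T * |C| * (1 + t) ^ (-(α / 2)), hs1, fun N R hR => ?_⟩
  have hmeas : Measurable (pairCorr ω₂ lam β γ T N) := (hmeasAll N).2
  have hsqb : ∀ t, |pairCorr ω₂ lam β γ T N t ^ 2| ≤ T ^ 2 := fun t => by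
    obtain ⟨-, hfnT, -, -, hcs⟩ := (hdict N).2.2.2.2 t
    rw [abs_of_nonneg (sq_nonneg _), sq T]
    exact hcs.trans (mul_le_mul_of_nonneg_left hfnT hT.le)
  have hgi : IntegrableOn (fun t => (1 + t) ^ (α / 2) * pairCorr ω₂ lam β γ T N t ^ 2) (Ioc 0 R) :=
    CoherentDephasing.TimeWeighted.integrableOn_Ioc_weighted_of_bounded ha0 (hmeas.pow_const 2) hsqb
  -- pointwise domination on `(0,R]`
  have hpt : ∀ t ∈ Ioc (0 : ℝ) R,
      (1 + t) ^ (α / 2) * pairCorr ω₂ lam β γ T N t ^ 2 ≤ T * |C| * (1 + t) ^ (-(α / 2)) := by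
    intro t ht
    have ht0 : 0 < t := ht.1
    have h1t : 0 < 1 + t := by linarith
    have hw0 : 0 ≤ (1 + t) ^ (α / 2) := Real.rpow_nonneg h1t.le _
    have hr2 : pairCorr ω₂ lam β γ T N t ^ 2 ≤ T * (|C| * (1 + t) ^ (-α)) :=
      calc pairCorr ω₂ lam β γ T N t ^ 2 ≤ T * fnorm ω₂ lam β γ T N t := hCS N t ht0.le
        _ ≤ T * (C * (1 + t) ^ (-α)) := mul_le_mul_of_nonneg_left (hS N t ht0.le) hT.le
        _ ≤ T * (|C| * (1 + t) ^ (-α)) := mul_le_mul_of_nonneg_left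
            (mul_le_mul_of_nonneg_right (le_abs_self C) (Real.rpow_nonneg h1t.le _)) hT.le
    calc (1 + t) ^ (α / 2) * pairCorr ω₂ lam β γ T N t ^ 2
        ≤ (1 + t) ^ (α / 2) * (T * (|C| * (1 + t) ^ (-α))) := mul_le_mul_of_nonneg_left hr2 hw0
      _ = T * |C| * ((1 + t) ^ (α / 2) * (1 + t) ^ (-α)) := by ring
      _ = T * |C| * (1 + t) ^ (-(α / 2)) := by
          rw [← Real.rpow_add h1t]; congr 1; congr 1; ring
  calc ∫ t in Ioc 0 R, (1 + t) ^ (α / 2) * pairCorr ω₂ lam β γ T N t ^ 2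
      ≤ ∫ t in Ioc 0 R, T * |C| * (1 + t) ^ (-(α / 2)) :=
        setIntegral_mono_on hgi (hdomI.mono_set Ioc_subset_Ioi_self) measurableSet_Ioc hpt
    _ ≤ ∫ t in Ioi (0 : ℝ), T * |C| * (1 + t) ^ (-(α / 2)) := by
        refine setIntegral_mono_set hdomI ?_ (Eventually.of_forall Ioc_subset_Ioi_self)
        filter_upwards [ae_restrict_mem measurableSet_Ioi] with t ht
        have ht0 : (0 : ℝ) < t := ht
        exact mul_nonneg hK0 (Real.rpow_nonneg (by linarith) _)

end Summit.AtomisticToContinuum.FouriersLaw.Theorems.PhononMeanFreePath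

end
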